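import Mathlib
import Literature.RingTheory.CohomologyAnnihilator.Basic
import Literature.AlgebraicGeometry.Resolution.LocalBlowup
import Summits.ResolutionOfSingularities.ResolutionOfSingularities.Theorems.HomologicalConductorGlobalisationLocEq
import Summits.ResolutionOfSingularities.ResolutionOfSingularities.Theorems.HomologicalConductorGlobalisationChartStep
import Summits.ResolutionOfSingularities.ResolutionOfSingularities.Theorems.HomologicalConductorGlobalisationNrmStep
import Summits.ResolutionOfSingularities.ResolutionOfSingularities.Theorems.HomologicalConductorGlobalisationTowerModel
import Summits.ResolutionOfSingularities.ResolutionOfSingularities.Theorems.SyzygyFlatteningHigherRankTerminationLocAt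
import HarnessLib

/-!
# Crux `StrictDrop` (stmt-ResolutionOfSingularities-16485), line `birth` — stub `stub_towerShape`

Route `ResolutionOfSingularities/HomologicalConductor`, stub S0 ("tower shape") of the line
`birth`: along the canonical normalised `ca`-tower `T₀ = loc A`, `T_(m+1) = loc (nrm (chart T_m))`
of a finitely generated `A ⊆ O ⊆ K = Frac A` (`O` a valuation ring of `K ⊇ k`; `loc` = localise at
the centre of `O` inside `K`, `chart` = the `O`-chart of the blow-up of the Iyengar–Takahashi
cohomology annihilator `ca`, `nrm` = normalise inside `K`), EVERY stage `T_m` has the tower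
`Shape`:

* `T_m = loc B` for a finitely generated `k`-subalgebra `B ≤ T_m` (so every element of `T_m` is a
  fraction `b * s⁻¹`, `b, s ∈ B`, `s⁻¹ ∈ O`);
* `T_m` is noetherian, lies in `O`, and is local at the centre of `O` (an element of `T_m`
  invertible in `O` is invertible in `T_m`).

This is where the line consumes `A.FG` and `IsFractionRing ↥A K` (both load-bearing: without
them the tower freezes at a non-noetherian valuation ring, `Theorems/StrictDrop/Negative/`).

## Proof

The same route's crux `Globalisation` (line `birth_HomologicalConductor`) has LANDED the tower
models of exactly this `let`-telescope: `HomologicalConductorGlobalisation.stub_towerModel`, fed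
with its three one-step stubs `stub_locEq` (`loc B`, as a subring, is the tree's
`Literature.AlgebraicGeometry.Resolution.locAtCentre B.toSubring O`), `stub_chartStep` (finitely
many chart generators `gⱼ * x₀⁻¹` suffice modulo units of the next local ring; `T_m` noetherian ⇒
`ca(T_m)` finitely generated) and `stub_nrmStep` (E. Noether's finiteness of normalisation +
"normalisation commutes with localisation", Stacks 0307), gives for every `m` a finitely
generated `A ≤ A_m ⊆ O` with `(T_m).toSubring = locAtCentre A_m.toSubring O`. The `Shape` of such
a stage is then read off the `locAtCentre` API of `LocalBlowup.lean`
(`shape_of_toSubring_eq_locAtCentre`): `B := A_m`; `loc A_m = T_m` by `stub_locEq` and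
`Subalgebra.toSubring_injective`; fractions by `mem_locAtCentre_iff`; noetherian as a localisation
(`isLocalization_locAtCentre`) of the noetherian `A_m` (Hilbert), transported along
`RingEquiv.subringCongr`; `⊆ O` by `locAtCentre_le`; local at the centre by `inv_mem_locAtCentre`
(units of the centre: `SyzygyFlattening.valuation_eq_one_of_inv_mem`,
`Literature.AlgebraicGeometry.Resolution.inv_mem_of_valuation_eq_one`, reused from the tree).

The statement is the registered stub with the route's `let`-bound tower inlined verbatim
(definitionally equal, `Iff.rfl`, to `Sig.stub_towerShape` of the line skeleton
`Cruxes/StrictDrop/Lines/birth.lean`).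
-/

noncomputable section

-- single-problem summit: the doubled namespace component is forced
set_option linter.dupNamespace false

namespace Summit.ResolutionOfSingularities.ResolutionOfSingularities.Theorems.StrictDrop.Birth.TowerShape

open Literature.AlgebraicGeometry.Resolution
open Summit.ResolutionOfSingularities.ResolutionOfSingularities.Theorems.HomologicalConductorGlobalisation
  (stub_locEq stub_chartStep stub_nrmStep stub_towerModel)
open Summit.ResolutionOfSingularities.ResolutionOfSingularities.Theorems.SyzygyFlattening
  (valuation_eq_one_of_inv_mem)

variable {k K : Type} [Field k] [Field K] [Algebra k K]

/-! ## The shape of a stage `T` with `T.toSubring = locAtCentre A_m.toSubring O` -/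

/-- **The tower `Shape` of a localised model.** If `T` is a `k`-subalgebra of `K` whose subring
is `locAtCentre Am.toSubring O` for a finitely generated `Am ⊆ O`, then: `Am ≤ T`,
`loc Am = T` (the route's `loc`, spelled out), every `t ∈ T` is `b * s⁻¹` with `b, s ∈ Am`,
`s⁻¹ ∈ O`; `T` is noetherian (localisation of the noetherian `Am`), `T ⊆ O`, and `T` is local at
the centre of `O`. This is literally the route's `Shape T`. [folklore] -/
theorem shape_of_toSubring_eq_locAtCentre (O : ValuationSubring K) (Am T : Subalgebra k K)
    (hAmfg : Am.FG) (hAmO : Am.toSubring ≤ O.toSubring)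
    (hT : T.toSubring = locAtCentre Am.toSubring O) :
    (∃ B : Subalgebra k K, B.FG ∧ B ≤ T ∧
        Algebra.adjoin k {y : K | ∃ a ∈ B, ∃ s ∈ B, s⁻¹ ∈ O ∧ y = a * s⁻¹} = T ∧
        ∀ t ∈ T, ∃ b ∈ B, ∃ s ∈ B, s⁻¹ ∈ O ∧ t = b * s⁻¹) ∧
      IsNoetherianRing ↥T ∧ T.toSubring ≤ O.toSubring ∧ ∀ s ∈ T, s⁻¹ ∈ O → s⁻¹ ∈ T := by
  have hTO : T.toSubring ≤ O.toSubring := by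
    rw [hT]
    exact locAtCentre_le hAmO
  refine ⟨⟨Am, hAmfg, fun x hx => ?_, ?_, fun t ht => ?_⟩, ?_, hTO, fun s hs hsO => ?_⟩
  · -- `Am ≤ T`
    have h : x ∈ locAtCentre Am.toSubring O := le_locAtCentre Am.toSubring O hx
    rw [← hT] at h
    exact h
  · -- `loc Am = T`: both have the subring `locAtCentre Am O`
    exact Subalgebra.toSubring_injective ((stub_locEq O Am hAmO).trans hT.symm)
  · -- every element of `T` is a fraction over `Am` with an `O`-unit denominator
    have ht' : t ∈ T.toSubring := ht
    rw [hT] at ht'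
    obtain ⟨a, ha, s, hs, hv, rfl⟩ := ht'
    exact ⟨a, ha, s, hs, inv_mem_of_valuation_eq_one O hv, div_eq_mul_inv a s⟩
  · -- noetherian: `T ≅ (Am)_{𝔪_O ∩ Am}` with `Am` noetherian (Hilbert)
    -- adapted from `chartStep_isNoetherianRing` (Theorems/HomologicalConductorGlobalisationChartStep)
    haveI : Algebra.FiniteType k ↥Am := Am.fg_iff_finiteType.mp hAmfg
    haveI hAmn : IsNoetherianRing ↥Am := Algebra.FiniteType.isNoetherianRing k ↥Am
    haveI : IsNoetherianRing ↥Am.toSubring := hAmn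
    haveI := isLocalization_locAtCentre hAmO
    haveI : IsNoetherianRing ↥(locAtCentre Am.toSubring O) :=
      IsLocalization.isNoetherianRing (subringCentre Am.toSubring O hAmO).primeCompl _
        inferInstance
    have hTn : IsNoetherianRing ↥T.toSubring :=
      isNoetherianRing_of_ringEquiv _ (RingEquiv.subringCongr hT).symm
    exact hTn
  · -- local at the centre
    by_cases hs0 : s = 0
    · rw [hs0, inv_zero]
      exact T.zero_mem
    have hs' : s ∈ T.toSubring := hs
    rw [hT] at hs'
    have hv : O.valuation s = 1 :=
      valuation_eq_one_of_inv_mem O (locAtCentre_le hAmO hs') hsO hs0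
    have h : s⁻¹ ∈ locAtCentre Am.toSubring O := inv_mem_locAtCentre hs' hv
    rw [← hT] at h
    exact h

/-! ## The stub, in the registered (inlined, `let`-bound) form -/

/-- **Stub `stub_towerShape` (S0) of line `birth` of the crux `StrictDrop`.** Every stage of the
canonical normalised `ca`-tower of a finitely generated `A ⊆ O ⊆ K = Frac A` along the valuation
ring `O` has the tower `Shape` (localisation at the centre of a finitely generated `B ≤ T_m`,
noetherian, inside `O`, local at the centre): by the landed tower models of the same route
(`HomologicalConductorGlobalisation.stub_towerModel` with `stub_locEq`, `stub_chartStep`,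
`stub_nrmStep`: E. Noether's finiteness of normalisation and finiteness of the chart modulo
units), `(T_m).toSubring = locAtCentre A_m.toSubring O` for a finitely generated `A ≤ A_m ⊆ O`,
and `shape_of_toSubring_eq_locAtCentre`. [folklore] -/
theorem stub_towerShape : ∀ p : ℕ, p.Prime → ∀ (k K : Type) [Field k] [CharP k p] [Field K] [Algebra k K] (O : ValuationSubring K) (A : Subalgebra k K), (∀ c : k, algebraMap k K c ∈ O) → A.FG → IsFractionRing ↥A K → A.toSubring ≤ O.toSubring → let ca : Subalgebra k K → Set K := fun A => {x : K | ∃ hx : x ∈ A, ∃ n : ℕ, ∀ i : ℕ, n ≤ i → ∀ (M N : ModuleCat.{0} ↥A), Module.Finite ↥A M → Module.Finite ↥A N → ∀ e : CategoryTheory.Abelian.Ext.{0} M N i, (⟨x, hx⟩ : ↥A) • e = 0}; let loc : Subalgebra k K → Subalgebra k K := fun A => Algebra.adjoin k {y : K | ∃ a ∈ A, ∃ s ∈ A, s⁻¹ ∈ O ∧ y = a * s⁻¹}; let chart : Subalgebra k K → Subalgebra k K := fun A => Algebra.adjoin k ((A : Set K) ∪ {y : K | ∃ c ∈ ca A, ∃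 x ∈ ca A, x ≠ 0 ∧ (∀ c' ∈ ca A, c' * x⁻¹ ∈ O) ∧ y = c * x⁻¹}); let nrm : Subalgebra k K → Subalgebra k K := fun B => Algebra.adjoin k {y : K | IsIntegral ↥B y}; let tower : Subalgebra k K → ℕ → Subalgebra k K := fun A m => @Nat.rec (fun _ => Subalgebra k K) (loc A) (fun _ B => loc (nrm (chart B))) m; let Shape : Subalgebra k K → Prop := fun T => (∃ B : Subalgebra k K, B.FG ∧ B ≤ T ∧ loc B = T ∧ ∀ t ∈ T, ∃ b ∈ B, ∃ s ∈ B, s⁻¹ ∈ O ∧ t = b * s⁻¹) ∧ IsNoetherianRing ↥T ∧ T.toSubring ≤ O.toSubring ∧ ∀ s ∈ T, s⁻¹ ∈ O → s⁻¹ ∈ T; ∀ m : ℕ, Shape (tower A m) := by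
  intro p _ k K _ _ _ _ O A _ hfg hfrac hle ca loc chart nrm tower Shape m
  -- the landed tower models of the route (same `let`-telescope, compared definitionally)
  have hmodel : ∃ Am : Subalgebra k K, Am.FG ∧ A ≤ Am ∧ Am.toSubring ≤ O.toSubring ∧
      (tower A m).toSubring = locAtCentre Am.toSubring O :=
    stub_towerModel stub_locEq stub_chartStep stub_nrmStep O A hfg hfrac hle m
  obtain ⟨Am, hAmfg, -, hAmO, hT⟩ := hmodel
  exact shape_of_toSubring_eq_locAtCentre O Am (tower A m) hAmfg hAmO hT

end Summit.ResolutionOfSingularities.ResolutionOfSingularities.Theorems.StrictDrop.Birth.TowerShape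

end
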